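import Summits.ABC.ABC.Theorems.PlacewiseSzpiroSingleTowerSzpiroFreySmallPrimes
import Literature.Barriers.ABC.BakerMethodBoundsEpsShapeThreshold
import HarnessLib

/-!
# Route PlacewiseSzpiro, crux `SingleTowerSzpiro` (stmt-ABC-22410), line `birth`:
# on the Frey locus the first deliverable IS the Stewart–Yu barrier, and it sits at the LARGE primes

Summits-side helper (theorems only; no definition, no named fact, no `Theses` import), sequel of
`…BakerSinglePlace.lean` (one tower `ν_p(abc) log p ≤ C(η) · p · rad^η`) and `…FreySmallPrimes.lean` (the Frey
tower at an odd place `v` with `p_v ≤ N^{1/3−2δ}` is `≤ C N^{1/3−δ}`). With `W = freyCurve a b` the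
Frey–Hellegouarch curve of an abc triple, `R = rad(abc)`, towers `ord_v(Δ_min(W)) · log p_v = 2 ν_{p_v}(abc) log p_v` at
odd `v`, and `Literature.Barriers.ABC.EpsShapeBound θ` = «`log c ≪_ε rad(abc)^{θ+ε}`» (Stewart–Yu 2001 gives
`θ = 1/3` = `BakerMethodBounds`; no `θ < 1/3` is known — the catalogued Baker-method barrier), this file PROVES:

* `epsShapeBound_of_odd_largePrime_bound` — modulo `PastenApproximationBound K` (Matveev + Yu 2007): if for some
  `0 < δ ≤ 1/6` the towers at the LARGE odd primes alone are sub-Stewart–Yu,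
  `∀ abc triples, ∀ odd p ∣ abc, p > R^{1/3−2δ} → ν_p(abc) log p ≤ C R^{1/3−δ}`, then `EpsShapeBound (1/3 − δ)` —
  Stewart–Yu's exponent is beaten. (The small primes are paid by the Baker method, `…BakerSinglePlace`; there are
  `≤ log₂ R` primes in all.) So **the whole Stewart–Yu wall of the line lives at the primes `p > N^{1/3}`.**
* `frey_odd_towers_le_of_epsShapeBound` — conversely `EpsShapeBound θ` (`θ ≥ 0`) bounds every odd Frey tower by
  `C N_W^{θ+ε}` (`2 ν_p log p ≤ 6 log c`, `R ≤ 2 N_W`; unconditional).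
* **`frey_odd_firstDeliverable_iff_exists_epsShapeBound_lt_third`** — modulo `PastenApproximationBound K`:
  **(FD on the Frey locus at the odd places) ⟺ ∃ θ < 1/3, EpsShapeBound θ.** Together with
  `firstDeliverable_iff_exists_szpiroEpsShape_lt_third` (all `E/ℚ`: FD ⟺ `∃ α < 1/3, SzpiroEpsShape α`,
  `…FirstDeliverableCalib.lean`) this calibrates the critic's first deliverable completely: over all `E` it is the
  open all-`E` Szpiro exponent `< 1/3`; on its home turf (Frey curves, where «`log|Δ_min| ≤` Stewart–Yu» is a
  theorem) it is EXACTLY «improve Stewart–Yu 2001», i.e. the barrier `Literature.Barriers.ABC.BakerMethodBounds`.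

HONESTY: orderings between typed statements only; no summit, rung or stub is proved; conditional (on
`PastenApproximationBound K`) ≠ proved; the crux, A1′ and A-PS are NOT abc; typed ≠ proved.
-/

noncomputable section

-- `Summit.<Summit>.<Problem>` is the mandated summit-side namespace (CONVENTIONS §2); for the
-- single-conjunct summit `ABC` the two coincide, so the duplicate `ABC.ABC` is deliberate.
set_option linter.dupNamespace false

namespace Summit.ABC.ABC.Theorems.SingleTowerSzpiroLine

open Finset IsDedekindDomain
open Literature.NumberTheory.DiophantineGeometry
open Literature.NumberTheory.DiophantineGeometry.Dioph
open Literature.NumberTheory.EllipticCurves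
open Literature.Barriers.ABC

/-! ### Elementary: one exponent against `log c`; the number of primes against `log rad` -/

/-- `ν_p(abc) · log p ≤ 3 log c` for an abc triple and any `p ≥ 1`... stated for primes:
`p^{ν_p(abc)} ∣ abc ≤ c³`. [folklore] -/
theorem factorization_mul_log_le_three_mul_log {a b c p : ℕ} (ht : IsABCTriple a b c) (hp : p.Prime) :
    ((a * b * c).factorization p : ℝ) * Real.log p ≤ 3 * Real.log c := by
  obtain ⟨ha, hb, habc, hcop⟩ := id ht
  have hc : 0 < c := by omega
  have h0 : a * b * c ≠ 0 := by positivity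
  have h1 : p ^ (a * b * c).factorization p ≤ a * b * c := Nat.ordProj_le p h0
  have h2 : a * b * c ≤ c ^ 3 := by
    have hac : a ≤ c := by omega
    have hbc : b ≤ c := by omega
    calc a * b * c ≤ c * c * c := by gcongr
      _ = c ^ 3 := by ring
  have hp0 : (0 : ℝ) < p := by exact_mod_cast hp.pos
  have h3 : ((p : ℝ)) ^ (a * b * c).factorization p ≤ (c : ℝ) ^ 3 := by exact_mod_cast h1.trans h2
  have h4 : Real.log ((p : ℝ) ^ (a * b * c).factorization p) ≤ Real.log ((c : ℝ) ^ 3) :=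
    Real.log_le_log (pow_pos hp0 _) h3
  rw [Real.log_pow, Real.log_pow] at h4
  push_cast at h4
  linarith

/-- `ω(abc) · log 2 ≤ log rad(abc)` (`2^{ω} ≤ ∏_{p ∣ abc} p = rad`). [folklore] -/
theorem card_primeFactors_mul_log_two_le_log_rad (a b c : ℕ) :
    ((a * b * c).primeFactors.card : ℝ) * Real.log 2 ≤ Real.log (rad a b c : ℝ) := by
  have h : 2 ^ (a * b * c).primeFactors.card ≤ rad a b c := by
    rw [rad_def, Nat.radical_eq_prod_primeFactors]
    exact Finset.pow_card_le_prod _ _ 2 fun p hp => (Nat.prime_of_mem_primeFactors hp).two_le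
  rw [← Real.log_pow]
  exact Real.log_le_log (by positivity) (by exact_mod_cast h)

/-! ### The large odd primes carry the whole Stewart–Yu wall -/

/-- **Beating Stewart–Yu from the large odd primes alone** (modulo `PastenApproximationBound K`). Let
`0 < δ ≤ 1/6`. If there is `C` with `ν_p(abc) · log p ≤ C · R^{1/3−δ}` for every abc triple and every ODD prime
`p ∣ abc` with `p > R^{1/3−2δ}` (`R = rad(abc)`), then `EpsShapeBound (1/3 − δ)`: for every `ε > 0`,
`log c ≤ κ R^{1/3−δ+ε}` for all abc triples. Proof: `log c = Σ_{p ∣ c} ν_p(c) log p`; the prime `2` and the odd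
primes `≤ R^{1/3−2δ}` cost `≤ 2C₁ R^{1/3−δ}` each by the Baker place bound
(`exists_single_place_bound_of_approximationBound` at `η = δ`; `δ ≤ 1/6`), the large odd primes `≤ C R^{1/3−δ}` by
hypothesis, and there are `≤ log₂ R` primes. [folklore] -/
theorem epsShapeBound_of_odd_largePrime_bound {K : ℝ} (hK : 1 ≤ K) (hP : PastenApproximationBound K)
    {δ : ℝ} (hδ : 0 < δ) (hδ6 : δ ≤ 1 / 6) {C : ℝ}
    (hlarge : ∀ a b c : ℕ, IsABCTriple a b c → ∀ p : ℕ, p.Prime → p ∣ a * b * c → p ≠ 2 →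
      (rad a b c : ℝ) ^ ((1 : ℝ) / 3 - 2 * δ) < p →
      ((a * b * c).factorization p : ℝ) * Real.log p ≤ C * (rad a b c : ℝ) ^ ((1 : ℝ) / 3 - δ)) :
    EpsShapeBound (1 / 3 - δ) := by
  obtain ⟨C₁, hC₁0, hC₁⟩ := exists_single_place_bound_of_approximationBound hK hP hδ
  have hl2 : (0 : ℝ) < Real.log 2 := Real.log_pos one_lt_two
  intro ε hε
  refine ⟨(2 * C₁ + max C 0) / (ε * Real.log 2), 0, fun a b c ht _ => ?_⟩
  obtain ⟨ha, hb, habc, hcop⟩ := id ht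
  have hc : 0 < c := by omega
  have h0 : a * b * c ≠ 0 := by positivity
  have hR2 : (2 : ℝ) ≤ (rad a b c : ℝ) := by exact_mod_cast IsABCTriple.two_le_rad ht
  set R : ℝ := (rad a b c : ℝ) with hRdef
  have hR1 : (1 : ℝ) ≤ R := by linarith
  have hR0 : (0 : ℝ) < R := by linarith
  set M : ℝ := (2 * C₁ + max C 0) * R ^ ((1 : ℝ) / 3 - δ) with hMdef
  have hRpow0 : 0 ≤ R ^ ((1 : ℝ) / 3 - δ) := Real.rpow_nonneg hR0.le _
  have hM0 : 0 ≤ M := by positivity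
  -- every prime of `c` contributes at most `M`
  have hterm : ∀ p ∈ c.primeFactors, ((c.factorization p : ℕ) : ℝ) * Real.log p ≤ M := by
    intro p hp
    have hpp : p.Prime := Nat.prime_of_mem_primeFactors hp
    have hpc : p ∣ c := Nat.dvd_of_mem_primeFactors hp
    have hpabc : p ∣ a * b * c := hpc.trans (Dvd.intro_left _ rfl)
    rw [← factorization_abc_eq_of_dvd_c ht hpp hpc]
    have hsmall := hC₁ a b c ht p hpp hpabc
    have hCle : C ≤ max C 0 := le_max_left _ _
    by_cases hp2 : p = 2
    · -- `p = 2`: `C₁ · 2 · R^δ ≤ 2 C₁ R^{1/3−δ}` as `δ ≤ 1/3 − δ`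
      subst hp2
      have hRδ : R ^ δ ≤ R ^ ((1 : ℝ) / 3 - δ) := Real.rpow_le_rpow_of_exponent_le hR1 (by linarith)
      calc (((a * b * c).factorization 2 : ℕ) : ℝ) * Real.log (2 : ℕ) ≤ C₁ * (2 : ℕ) * R ^ δ := hsmall
        _ = 2 * C₁ * R ^ δ := by push_cast; ring
        _ ≤ 2 * C₁ * R ^ ((1 : ℝ) / 3 - δ) := mul_le_mul_of_nonneg_left hRδ (by positivity)
        _ ≤ M := by
            rw [hMdef]
            exact mul_le_mul_of_nonneg_right (by linarith [le_max_right C 0]) hRpow0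
    · by_cases hple : (p : ℝ) ≤ R ^ ((1 : ℝ) / 3 - 2 * δ)
      · -- small odd prime: `C₁ p R^δ ≤ C₁ R^{1/3−2δ} R^δ = C₁ R^{1/3−δ}`
        have hRδ0 : 0 ≤ R ^ δ := Real.rpow_nonneg hR0.le _
        calc (((a * b * c).factorization p : ℕ) : ℝ) * Real.log p ≤ C₁ * p * R ^ δ := hsmall
          _ ≤ C₁ * R ^ ((1 : ℝ) / 3 - 2 * δ) * R ^ δ :=
              mul_le_mul_of_nonneg_right (mul_le_mul_of_nonneg_left hple hC₁0.le) hRδ0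
          _ = C₁ * R ^ ((1 : ℝ) / 3 - δ) := by rw [mul_assoc, ← Real.rpow_add hR0]; ring_nf
          _ ≤ M := by
              rw [hMdef]
              exact mul_le_mul_of_nonneg_right (by linarith [le_max_right C 0]) hRpow0
      · -- large odd prime: hypothesis
        have h := hlarge a b c ht p hpp hpabc hp2 (not_le.mp hple)
        calc (((a * b * c).factorization p : ℕ) : ℝ) * Real.log p ≤ C * R ^ ((1 : ℝ) / 3 - δ) := h
          _ ≤ max C 0 * R ^ ((1 : ℝ) / 3 - δ) := mul_le_mul_of_nonneg_right hCle hRpow0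
          _ ≤ M := by
              rw [hMdef]
              exact mul_le_mul_of_nonneg_right (by linarith) hRpow0
  -- sum over the primes of `c`, count them against `log R`
  have hlogc : Real.log c = ∑ p ∈ c.primeFactors, (c.factorization p : ℝ) * Real.log p :=
    log_eq_sum_factorization_mul_log hc.ne'
  have hcard_c : (c.primeFactors.card : ℝ) ≤ ((a * b * c).primeFactors.card : ℝ) := by
    exact_mod_cast Finset.card_le_card (Nat.primeFactors_mono (Dvd.intro_left _ rfl) h0)
  have hcard : ((a * b * c).primeFactors.card : ℝ) ≤ Real.log R / Real.log 2 := by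
    rw [le_div_iff₀ hl2]; exact card_primeFactors_mul_log_two_le_log_rad a b c
  have hlogR : Real.log R ≤ R ^ ε / ε := Real.log_le_rpow_div hR0.le hε
  calc Real.log c = ∑ p ∈ c.primeFactors, (c.factorization p : ℝ) * Real.log p := hlogc
    _ ≤ ∑ p ∈ c.primeFactors, M := Finset.sum_le_sum hterm
    _ = (c.primeFactors.card : ℝ) * M := by rw [Finset.sum_const, nsmul_eq_mul]
    _ ≤ Real.log R / Real.log 2 * M := mul_le_mul_of_nonneg_right (hcard_c.trans hcard) hM0
    _ ≤ (R ^ ε / ε) / Real.log 2 * M := by gcongr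
    _ = (2 * C₁ + max C 0) / (ε * Real.log 2) * (R ^ ((1 : ℝ) / 3 - δ) * R ^ ε) := by
        rw [hMdef]; field_simp
    _ = (2 * C₁ + max C 0) / (ε * Real.log 2) * R ^ ((1 : ℝ) / 3 - δ + ε : ℝ) := by
        rw [← Real.rpow_add hR0]

/-! ### Conversely: an `ε`-shape bounds every odd Frey tower (unconditional) -/

/-- **`EpsShapeBound θ` ⟹ every odd Frey tower is `≤ C(ε) · N_W^{θ+ε}`** (`θ ≥ 0`, every `ε > 0`, `C > 0`):
`ord_v(Δ_min(W)) log p_v = 2 ν_p(abc) log p ≤ 6 log c ≤ 6κ R^{θ+ε} ≤ 6κ (2N_W)^{θ+ε}` (threshold-free form of the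
`ε`-shape, `epsShapeBound_iff_thresholdFree`; `rad ≤ 2 N_W`). Unconditional. [folklore] -/
theorem frey_odd_towers_le_of_epsShapeBound {θ : ℝ} (hθ : 0 ≤ θ) (h : EpsShapeBound θ) {ε : ℝ} (hε : 0 < ε) :
    ∃ C : ℝ, 0 < C ∧ ∀ a b c : ℕ, IsABCTriple a b c → ∀ v : HeightOneSpectrum ℤ,
      Rat.HeightOneSpectrum.natGenerator v ≠ 2 →
      ((freyCurve (a : ℤ) (b : ℤ)).ordMinimalDiscriminant v : ℝ) *
          Real.log (Rat.HeightOneSpectrum.natGenerator v : ℝ) ≤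
        C * (((freyCurve (a : ℤ) (b : ℤ)).conductorNorm ℤ : ℕ) : ℝ) ^ (θ + ε) := by
  obtain ⟨κ, hκ⟩ := (epsShapeBound_iff_thresholdFree hθ).mp h ε hε
  refine ⟨6 * max κ 0 * (2 : ℝ) ^ (θ + ε) + 1, by positivity, fun a b c ht v hv => ?_⟩
  haveI := ht.freyCurve_isElliptic
  have hp : (Rat.HeightOneSpectrum.natGenerator v).Prime := Rat.HeightOneSpectrum.prime_natGenerator v
  have hN1 : (1 : ℝ) ≤ (((freyCurve (a : ℤ) (b : ℤ)).conductorNorm ℤ : ℕ) : ℝ) := by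
    exact_mod_cast WeierstrassCurve.conductorNorm_pos_holds (freyCurve (a : ℤ) (b : ℤ))
  set N : ℝ := (((freyCurve (a : ℤ) (b : ℤ)).conductorNorm ℤ : ℕ) : ℝ) with hNdef
  have hN0 : (0 : ℝ) ≤ N := by linarith
  have hRN : (rad a b c : ℝ) ≤ 2 * N := rad_le_two_mul_conductorNorm_freyCurve ht
  have hR0 : (0 : ℝ) ≤ (rad a b c : ℝ) := by positivity
  have hθε : 0 ≤ θ + ε := by linarith
  have hRpow : (rad a b c : ℝ) ^ (θ + ε) ≤ (2 : ℝ) ^ (θ + ε) * N ^ (θ + ε) := by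
    rw [← Real.mul_rpow (by norm_num) hN0]; exact Real.rpow_le_rpow hR0 hRN hθε
  have hNpow1 : (1 : ℝ) ≤ N ^ (θ + ε) := Real.one_le_rpow hN1 hθε
  have h1 := hκ a b c ht
  have h2 := factorization_mul_log_le_three_mul_log ht hp
  rw [frey_tower_eq ht v hv]
  calc 2 * ((((a * b * c).factorization (Rat.HeightOneSpectrum.natGenerator v) : ℕ) : ℝ) *
          Real.log (Rat.HeightOneSpectrum.natGenerator v : ℝ))
      ≤ 6 * Real.log c := by linarith
    _ ≤ 6 * (max κ 0 * (rad a b c : ℝ) ^ (θ + ε)) := by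
        have : κ * (rad a b c : ℝ) ^ (θ + ε) ≤ max κ 0 * (rad a b c : ℝ) ^ (θ + ε) :=
          mul_le_mul_of_nonneg_right (le_max_left κ 0) (Real.rpow_nonneg hR0 _)
        linarith
    _ ≤ 6 * (max κ 0 * ((2 : ℝ) ^ (θ + ε) * N ^ (θ + ε))) := by gcongr
    _ = 6 * max κ 0 * (2 : ℝ) ^ (θ + ε) * N ^ (θ + ε) := by ring
    _ ≤ (6 * max κ 0 * (2 : ℝ) ^ (θ + ε) + 1) * N ^ (θ + ε) := by nlinarith

/-! ### The calibration on the Frey locus -/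

/-- **On the Frey locus, modulo Matveev + Yu, the first deliverable at the odd places ⟺ beating Stewart–Yu.**
Assuming `PastenApproximationBound K` (`K ≥ 1`):
`(∃ δ > 0, ∃ C, ∀ abc triples, ∀ v ∤ 2, ord_v(Δ_min(W)) · log p_v ≤ C · N_W^{1/3−δ}) ↔ ∃ θ < 1/3, EpsShapeBound θ`.
(⇐) `frey_odd_towers_le_of_epsShapeBound` (unconditional). (⇒) with `δ' = min δ (1/6)`: every odd tower gives
`ν_p(abc) log p ≤ 128 · max C 0 · R^{1/3−δ'}` at EVERY odd `p ∣ abc` (`N_W ≤ 2⁸ R`), in particular at the large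
ones, and `epsShapeBound_of_odd_largePrime_bound` pays the small ones. The right-hand side is the negation of the
state of the art catalogued as `Literature.Barriers.ABC.BakerMethodBounds` (`θ = 1/3`, Stewart–Yu 2001).
[folklore] -/
theorem frey_odd_firstDeliverable_iff_exists_epsShapeBound_lt_third {K : ℝ} (hK : 1 ≤ K)
    (hP : PastenApproximationBound K) :
    (∃ δ : ℝ, 0 < δ ∧ ∃ C : ℝ, ∀ a b c : ℕ, IsABCTriple a b c → ∀ v : HeightOneSpectrum ℤ,
      Rat.HeightOneSpectrum.natGenerator v ≠ 2 →
      ((freyCurve (a : ℤ) (b : ℤ)).ordMinimalDiscriminant v : ℝ) *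
          Real.log (Rat.HeightOneSpectrum.natGenerator v : ℝ) ≤
        C * (((freyCurve (a : ℤ) (b : ℤ)).conductorNorm ℤ : ℕ) : ℝ) ^ ((1 : ℝ) / 3 - δ)) ↔
    ∃ θ : ℝ, θ < 1 / 3 ∧ EpsShapeBound θ := by
  constructor
  · rintro ⟨δ, hδ, C, hC⟩
    set δ' : ℝ := min δ (1 / 6) with hδ'
    have hδ'0 : 0 < δ' := lt_min hδ (by norm_num)
    have hδ'6 : δ' ≤ 1 / 6 := min_le_right _ _
    have hδ'δ : δ' ≤ δ := min_le_left _ _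
    refine ⟨1 / 3 - δ', by linarith, epsShapeBound_of_odd_largePrime_bound hK hP hδ'0 hδ'6
      (C := 128 * max C 0) fun a b c ht p hp hpabc hp2 _ => ?_⟩
    haveI := ht.freyCurve_isElliptic
    -- the place `v` of `p`
    set v : HeightOneSpectrum ℤ := (Rat.HeightOneSpectrum.primesEquiv (R := ℤ)).symm ⟨p, hp⟩ with hvdef
    have hgen : Rat.HeightOneSpectrum.natGenerator v = p :=
      congrArg Subtype.val ((Rat.HeightOneSpectrum.primesEquiv (R := ℤ)).apply_symm_apply ⟨p, hp⟩)
    have hv2 : Rat.HeightOneSpectrum.natGenerator v ≠ 2 := by rw [hgen]; exact hp2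
    have htow := hC a b c ht v hv2
    rw [frey_tower_eq ht v hv2, hgen] at htow
    -- `N ≤ 256 R`, exponent `1/3 − δ' ≥ 1/6 > 0`
    have hN1 : (1 : ℝ) ≤ (((freyCurve (a : ℤ) (b : ℤ)).conductorNorm ℤ : ℕ) : ℝ) := by
      exact_mod_cast WeierstrassCurve.conductorNorm_pos_holds (freyCurve (a : ℤ) (b : ℤ))
    have hNR : (((freyCurve (a : ℤ) (b : ℤ)).conductorNorm ℤ : ℕ) : ℝ) ≤ 2 ^ 8 * (rad a b c : ℝ) :=
      ht.conductorNorm_freyCurve_le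
    set N : ℝ := (((freyCurve (a : ℤ) (b : ℤ)).conductorNorm ℤ : ℕ) : ℝ) with hNdef
    have hN0 : (0 : ℝ) ≤ N := by linarith
    have hR1 : (1 : ℝ) ≤ (rad a b c : ℝ) := by
      exact_mod_cast le_trans one_le_two (IsABCTriple.two_le_rad ht)
    have hR0 : (0 : ℝ) ≤ (rad a b c : ℝ) := by linarith
    have hexp0 : 0 ≤ (1 : ℝ) / 3 - δ' := by linarith
    have hNpow : N ^ ((1 : ℝ) / 3 - δ) ≤ N ^ ((1 : ℝ) / 3 - δ') :=
      Real.rpow_le_rpow_of_exponent_le hN1 (by linarith)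
    have hNpow' : N ^ ((1 : ℝ) / 3 - δ') ≤ (2 ^ 8 : ℝ) ^ ((1 : ℝ) / 3 - δ') * (rad a b c : ℝ) ^ ((1 : ℝ) / 3 - δ') := by
      rw [← Real.mul_rpow (by norm_num) hR0]; exact Real.rpow_le_rpow hN0 hNR hexp0
    have h256 : (2 ^ 8 : ℝ) ^ ((1 : ℝ) / 3 - δ') ≤ 256 := by
      calc (2 ^ 8 : ℝ) ^ ((1 : ℝ) / 3 - δ') ≤ (2 ^ 8 : ℝ) ^ (1 : ℝ) :=
            Real.rpow_le_rpow_of_exponent_le (by norm_num) (by linarith)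
        _ = 256 := by norm_num
    have hRpow0 : 0 ≤ (rad a b c : ℝ) ^ ((1 : ℝ) / 3 - δ') := Real.rpow_nonneg hR0 _
    have hC0 : 0 ≤ max C 0 := le_max_right _ _
    have key : C * N ^ ((1 : ℝ) / 3 - δ) ≤ max C 0 * (256 * (rad a b c : ℝ) ^ ((1 : ℝ) / 3 - δ')) :=
      calc C * N ^ ((1 : ℝ) / 3 - δ) ≤ max C 0 * N ^ ((1 : ℝ) / 3 - δ) :=
            mul_le_mul_of_nonneg_right (le_max_left C 0) (Real.rpow_nonneg hN0 _)
        _ ≤ max C 0 * N ^ ((1 : ℝ) / 3 - δ') := mul_le_mul_of_nonneg_left hNpow hC0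
        _ ≤ max C 0 * ((2 ^ 8 : ℝ) ^ ((1 : ℝ) / 3 - δ') * (rad a b c : ℝ) ^ ((1 : ℝ) / 3 - δ')) :=
            mul_le_mul_of_nonneg_left hNpow' hC0
        _ ≤ max C 0 * (256 * (rad a b c : ℝ) ^ ((1 : ℝ) / 3 - δ')) :=
            mul_le_mul_of_nonneg_left (mul_le_mul_of_nonneg_right h256 hRpow0) hC0
    have hlhs0 : 0 ≤ (((a * b * c).factorization p : ℕ) : ℝ) * Real.log p := by
      have : (1 : ℝ) ≤ p := by exact_mod_cast hp.one_lt.le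
      have := Real.log_nonneg this
      positivity
    nlinarith
  · rintro ⟨θ, hθ, hE⟩
    have hθ0 : 0 ≤ max θ 0 := le_max_right _ _
    have hθ3 : max θ 0 < 1 / 3 := max_lt hθ (by norm_num)
    have hE' : EpsShapeBound (max θ 0) := epsShapeBound_mono (le_max_left θ 0) hE
    obtain ⟨C, hC0, hC⟩ := frey_odd_towers_le_of_epsShapeBound hθ0 hE'
      (show (0 : ℝ) < (1 / 3 - max θ 0) / 2 by linarith)
    refine ⟨(1 / 3 - max θ 0) / 2, by linarith, C, fun a b c ht v hv => ?_⟩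
    have h := hC a b c ht v hv
    have hexp : max θ 0 + (1 / 3 - max θ 0) / 2 = (1 : ℝ) / 3 - (1 / 3 - max θ 0) / 2 := by ring
    rwa [hexp] at h

end Summit.ABC.ABC.Theorems.SingleTowerSzpiroLine

end
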